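import Mathlib
import Summits.Ventures.HodgeRepro2.LevelPositivity
import Summits.Ventures.HodgeRepro2.T5VanDantzig

/-!
# A decreasing countable basis of compact open subgroups

Blind cell `pub-hodge-repro2`, seat p8 (gen 5), Tier-5 kernel support.  `T5VanDantzig`
(p392858) produces a countable family of compact open subgroups below which every open subgroup
lies; the Hecke-algebra dictionary of `T5CornerSmooth` wants the family DECREASING (so that the
averaging idempotents satisfy `e_{K_j} e_{K_i} = e_{K_i}` for `i ≤ j`).  This file nests the
family by finite intersections (`LevelPositivity.isCompact_inf_of_isCompact_left`, p388321):

* `exists_antitone_basis_compact_openSubgroup` — in a first-countable locally compact Hausdorff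
  totally disconnected group there is an ANTITONE sequence `K n` of compact open subgroups such
  that every open subgroup contains some `K n`.

README §8(d): uses an L-value-free non-vanishing device: NO.
-/

namespace Summit.Ventures.HodgeRepro2.T5VanDantzigNested

open Summit.Ventures.HodgeRepro2.LevelPositivity

variable {G : Type*} [TopologicalSpace G] [Group G] [IsTopologicalGroup G]

/-- The running intersection `K 0 ⊓ … ⊓ K n` of a sequence of open subgroups. -/
def runningInf (K : ℕ → OpenSubgroup G) : ℕ → OpenSubgroup G
  | 0 => K 0
  | n + 1 => runningInf K n ⊓ K (n + 1)

omit [IsTopologicalGroup G] in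
/-- `runningInf K n ≤ K n`. -/
theorem runningInf_le (K : ℕ → OpenSubgroup G) (n : ℕ) : runningInf K n ≤ K n := by
  cases n with
  | zero => exact le_rfl
  | succ n => exact inf_le_right

omit [IsTopologicalGroup G] in
/-- `runningInf K` is antitone. -/
theorem runningInf_antitone (K : ℕ → OpenSubgroup G) : Antitone (runningInf K) :=
  antitone_nat_of_succ_le fun _ => inf_le_left

/-- `runningInf K n` is compact when every `K n` is. -/
theorem isCompact_runningInf (K : ℕ → OpenSubgroup G) (hK : ∀ n, IsCompact (K n : Set G)) (n : ℕ) :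
    IsCompact (runningInf K n : Set G) := by
  induction n with
  | zero => exact hK 0
  | succ n ih => exact isCompact_inf_of_isCompact_left (runningInf K n) (K (n + 1)) ih

/-- **A decreasing countable basis of compact open subgroups.** -/
theorem exists_antitone_basis_compact_openSubgroup [LocallyCompactSpace G] [T2Space G]
    [TotallyDisconnectedSpace G] [FirstCountableTopology G] :
    ∃ K : ℕ → OpenSubgroup G, Antitone K ∧ (∀ n, IsCompact (K n : Set G)) ∧
      ∀ U : Subgroup G, IsOpen (U : Set G) → ∃ n, (K n).toSubgroup ≤ U := by
  obtain ⟨K, hKc, hbasis⟩ := T5VanDantzig.exists_countable_basis_compact_openSubgroup (G := G)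
  refine ⟨runningInf K, runningInf_antitone K, isCompact_runningInf K hKc, fun U hU => ?_⟩
  obtain ⟨n, hn⟩ := hbasis U hU
  exact ⟨n, fun g hg => hn (runningInf_le K n hg)⟩

end Summit.Ventures.HodgeRepro2.T5VanDantzigNested
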